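import Summits.Langlands.Langlands.Statement
import Summits.Langlands.Langlands.Theorems.BaseFieldAscentReciprocityTRCMStubDescentOfAutomorphy
import Summits.Langlands.Langlands.Theorems.BaseFieldAscentReciprocityTRCMTwistMatching
import Summits.Langlands.Langlands.Theorems.BaseFieldAscentReciprocityTRCMArchimedeanDescentFacts
import HarnessLib

/-!
# The quadratic layer of descent of weak automorphy over a totally real base
# (crux `ReciprocityTRCM`, stmt-Langlands-1093, line `registered`; `--supports` helper toward the registered
# stub `stub_descentOfAutomorphy` = item stmt-Langlands-1062 `LiftDescend.DescentOfAutomorphy`)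

Support file (closes nothing).  Since skeleton v8 (lead cycle 5) the crux consumes item 1062 twice: over a CM base
with an ARBITRARY finite Galois `F'/F` (piece `X₂`; the open insoluble core lives there) and over a TOTALLY REAL base
with `F' = E` a CM QUADRATIC extension only (the weak direction (B) over totally real fields,
`weakGalToAutTR_of_descentOfAutomorphy`, module `…OfDescent`).  This file isolates the second use as a theorem
modulo the two trace-formula inputs it really costs — item stmt-Langlands-18032 `ArthurClozelCuspidalDescent`
(Arthur–Clozel 1989 Ch. 3 Thm. 4.2 (d), verbatim) and the Literature named fact
`ArthurClozel1989_strongLifting_archimedean` (Ch. 3 Thm. 5.1, archimedean clause):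

`descentOfAutomorphy_quadraticLayer_of_isTotallyReal : <18032> → AC-5.1-arch → ∀ F totally real, ∀ 𝓡 with (A) in
all ranks, ∀ n > 0, ℓ, ι, ρ, (∃ Galois quadratic E/F with ρ|_E irreducible and weakly cuspidal-automorphic
(L-algebraic) over E) → ρ weakly cuspidal-automorphic (L-algebraic) over F`

— the statement of item 1062 with `F` totally real and `[F' : F] = 2` (no CM hypothesis on `E`, no irreducibility or
geometricity of `ρ` over `F` needed).  Proof = the cycle-1 derivation of the former stub 5, with the avatar `P` GIVEN:
the Satake data of `P` are `Gal(E/F)`-stable (`stub_isGaloisStableSatakeAE_of_compatible_restrictField`, p157885);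
cyclic descent of prime degree 2 gives `π₁` over `F` with `P` a weak base change lift, L-algebraic by the archimedean
clause and Clozel's infinity types over a totally real field (`quadraticDescentLAlgebraic_of_isTotallyReal`, p162079);
`ρ` matches `π₁` or its quadratic twist (`stub_twistMatchingOfQuadraticDescent`, p159395, using (A) over `F`).
So on the totally real side the crux asks of 1062 only a theorem-level (trace-formula) layer; the open content of
1062 enters the crux through CM bases alone.  Standard axioms; no definitions; route-free.

## References
* J. Arthur, L. Clozel, *Simple algebras, base change, and the advanced theory of the trace formula*,
  Ann. of Math. Stud. 120 (1989), Ch. 3 Thm. 4.2 (d), Thm. 5.1, Thm. 6.2. [ArthurClozelAMS120]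
* L. Clozel, *Motifs et formes automorphes* (1990), §3.3. [Clozel1990]
* T. Barnet-Lamb, T. Gee, D. Geraghty, R. Taylor, Ann. of Math. 179 (2014), §5. [BarnetlambEtAl2014]
-/

noncomputable section

set_option linter.dupNamespace false -- project-wide option (lakefile weak.linter.dupNamespace); `Summit.Langlands.Langlands` is the mandated namespace

open scoped MatrixGroups NumberField
open NumberField IsDedekindDomain Filter
open Literature.NumberTheory.Automorphic Literature.NumberTheory.GaloisRepresentations
open Summit.Langlands

namespace Summit.Langlands.Langlands.Theorems.ReciprocityTRCM

/-- **Descent of weak automorphy along a quadratic extension of a totally real field** (the layer of item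
stmt-Langlands-1062 the crux uses on the totally real side), from Arthur–Clozel cuspidal descent (item
stmt-Langlands-18032, verbatim) and the archimedean clause of strong lifting (named fact): for `F` totally real,
`𝓡` with (A) in all ranks, and `ρ : Γ_F → GL_n(ℚ̄_ℓ)` whose restriction to some Galois quadratic `E/F` is irreducible
and Satake–Frobenius compatible a.e. with an L-algebraic cuspidal `P` over `E`, there is an L-algebraic cuspidal `π`
over `F` Satake–Frobenius compatible a.e. with `ρ`.
[cite: ArthurClozelAMS120, Ch. 3 Thm. 4.2 (d), Thm. 5.1 and Thm. 6.2] [cite: Clozel1990, §3.3] -/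
theorem descentOfAutomorphy_quadraticLayer_of_isTotallyReal
    (hdesc : ∀ (n : ℕ) (F E : Type) [Field F] [NumberField F] [Field E] [NumberField E] [Algebra F E] [IsGalois F E] (hF : Literature.NumberTheory.Automorphic.isCompact_glFiniteIntegralLevel n F) (hE : Literature.NumberTheory.Automorphic.isCompact_glFiniteIntegralLevel n E), IsCyclic (E ≃ₐ[F] E) → (Module.finrank F E).Prime → ∀ P : Literature.NumberTheory.Automorphic.CuspidalAutomorphicRepData n E hE, (∀ᶠ w : IsDedekindDomain.HeightOneSpectrum (NumberField.RingOfIntegers E) in Filter.cofinite, ∀ w' : IsDedekindDomain.HeightOneSpectrum (NumberField.RingOfIntegers E), w'.asIdeal.under (NumberField.RingOfIntegers F) = w.asIdeal.under (NumberField.RingOfIntegers F) → ∀ α : Multiset ℂ, P.1.HasSatakeParamAt w α → P.1.HasSatakeParamAt w' α) → ∃ π : Literature.NumberTheory.Automorphic.CuspidalAutomorphicRepData n F hF, ∀ᶠ w : IsDedekindDomain.HeightOneSpectrum (NumberField.RingOfIntegers E) in Filter.cofinite, ∀ (v : IsDedekindDomain.HeightOneSpectrum (NumberField.RingOfIntegers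 F)) (α : Multiset ℂ), w.asIdeal.under (NumberField.RingOfIntegers F) = v.asIdeal → π.1.HasSatakeParamAt v α → P.1.HasSatakeParamAt w (α.map (· ^ w.asIdeal.inertiaDeg (NumberField.RingOfIntegers F))))
    (harch : Literature.NumberTheory.Automorphic.ArthurClozel1989_strongLifting_archimedean) :
    ∀ (F : Type) [Field F] [NumberField F], NumberField.IsTotallyReal F → ∀ R : ReciprocityData F, (∀ n : ℕ, 0 < n → ∀ hcpt : Literature.NumberTheory.Automorphic.isCompact_glFiniteIntegralLevel n F, AutomorphicToGalois n R hcpt) → ∀ (n : ℕ), 0 < n → ∀ (ℓ : ℕ) [Fact ℓ.Prime] (ι : PadicAlgCl ℓ ≃+* ℂ) (ρ : Literature.NumberTheory.GaloisRepresentations.FramedGaloisRep F (PadicAlgCl ℓ) n), (∃ (E : Type) (_ : Field E) (_ : NumberField E) (_ : Algebra F E) (_ : IsGalois F E), Module.finrank F E = 2 ∧ (ρ.restrictField E).toGaloisRep.IsIrreducible ∧ ∃ (hcptE : Literature.NumberTheory.Automorphic.isCompact_glFiniteIntegralLevel n E) (P : Literature.NumberTheory.Automorphic.CuspidalAutomorphicRepData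 n E hcptE), P.1.IsLAlgebraic ∧ ∀ᶠ w : IsDedekindDomain.HeightOneSpectrum (NumberField.RingOfIntegers E) in cofinite, SatakeFrobCompatibleAt ι P.1 (ρ.restrictField E) w) → ∀ hcpt : Literature.NumberTheory.Automorphic.isCompact_glFiniteIntegralLevel n F, ∃ π : Literature.NumberTheory.Automorphic.CuspidalAutomorphicRepData n F hcpt, π.1.IsLAlgebraic ∧ ∀ᶠ v : IsDedekindDomain.HeightOneSpectrum (NumberField.RingOfIntegers F) in cofinite, SatakeFrobCompatibleAt ι π.1 ρ v := by
  -- item 18032 IS the Literature fact `cuspidal_descent_cyclic` (predicates unfolded), definitionally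
  have hdesc' : Literature.NumberTheory.Automorphic.cuspidal_descent_cyclic := hdesc
  have h5A1 := quadraticDescentLAlgebraic_of_isTotallyReal hdesc' harch
  intro F _ _ hTR R hA n hn ℓ _ ι ρ hpot hcpt
  obtain ⟨E, iF, iN, iA, iG, h2, hirrE, hcptE, P, hPL, hsat⟩ := hpot
  have hstab : Literature.NumberTheory.Automorphic.IsGaloisStableSatakeAE F P.1 :=
    stub_isGaloisStableSatakeAE_of_compatible_restrictField F E n hcptE ℓ ι P.1 ρ hsat
  obtain ⟨π₁, hπ₁L, hBC⟩ := h5A1 n F E hTR h2 hcpt hcptE P hPL hstab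
  exact stub_twistMatchingOfQuadraticDescent n F E h2 R hcpt hcptE (hA n hn hcpt) ℓ ι ρ hirrE P π₁ hπ₁L
    hBC hsat

end Summit.Langlands.Langlands.Theorems.ReciprocityTRCM

end
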